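import Literature.Geometry.ComplexAnalytic.PhamBrieskornCyclicNodeCohomology
import Literature.AlgebraicTopology.SingularHomology.HomologySelfMapFixingOpenSet
import Literature.AlgebraicTopology.SingularHomology.CohomologySelfMapTransferOfField
import HarnessLib

/-!
# The local-monodromy datum of a cyclic-node degeneration from a GEOMETRIC monodromy supported in a Milnor ball
# (the interface of programme "localisation of the nodal meridian monodromy"; Picard–Lefschetz, AGZV II §1.1)

Layer `Literature/Geometry/ComplexAnalytic`; theorems only (no definition, no named fact). Written by the prover seat
`hodge-nonav-prover-Ax` (g9) for crux K1 of the route `Summits/HodgeConjecture/HodgeConjecture/Theses/CyclicUnitaryPowers.lean`.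

The cited fact `HodgeTheory.carlsonToledo1999_nodalMeridianLocalMonodromyBound` (the Picard–Lefschetz input of the
crux after the 2026-08-28 re-cut) asserts, for the transport `T` of a meridian centred at a one-nodal branch curve:
`∃ V, (T − 1)H² ⊆ V ∧ Σ_{i<p} T^i|_V = 0 ∧ dim V ≤ p − 1`. This file proves that conclusion for ANY automorphism
`T` of `H²(Y; ℚ)` of ANY space `Y` which is induced by a self-map `h : Y → Y` that is the identity on an open set `B`
and, on an open set `A` with `A ∪ B = Y`, `h(A) ⊆ A`, is topologically conjugate to the MODEL MONODROMY
`(z₀, z₁, z₂) ↦ (−z₀, −z₁, ζ z₂)` (`ζ` a primitive `p`-th root of unity) of the affine Milnor fibre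
`F = {z₀² + z₁² + z₂^p = 1}` of the cyclic node (`Geometry/ComplexAnalytic/PhamBrieskorn*`):
**`exists_localisation_of_conj_modelMonodromy`**. So the discharge of the cited fact is reduced to GEOMETRY alone: a
geometric monodromy of the nearby fibre `X_ε` of the pencil `x₃^p = f₁ + c·g` supported in a Milnor ball around the
`A_{p−1}` point and conjugate there to the model, realising the cohomological transport
(`HodgeTheory.DirectImageIsotopy.transportFun_eq_of_isotopy`).

Ingredients (all proved): the excision localisation `singularHomology.map_sub_self_mem_range_of_eqOn`,
`…sum_smul_pow_map_sub_self_eq_zero_of_eqOn`, `…finrank_range_sub_id_le_of_eqOn` (`HomologySelfMapFixingOpenSet`);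
the Kronecker transfer `finrank_range_cohomologyMap_sub_id_eq`, `sum_smul_pow_cohomologyMap_apply_sub_eq_zero`
(`CohomologySelfMapTransferOfField`); the local model `finrank_rat_singularHomology_fibre_cyclicNode`,
`sum_pow_map_rotateFibre_eq_zero`, `map_modelMonodromy_eq_map_rotateFibre`.

## References

* [ArnoldGuseinzadeVarchenko2012] V. I. Arnold, S. M. Gusein-Zade, A. N. Varchenko, Singularities of Differentiable
  Maps, Vol. 2, Part I §1.1 (the monodromy is the identity off the ball; variation operator; held text p0013, p0025).
* [CarlsonToledo1999] J. A. Carlson, D. Toledo, Duke Math. J. 97 (1999), §6 (kdoublept) (held text p0013–p0014).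
* [Milnor1968] J. Milnor, Singular points of complex hypersurfaces, §9 Thm. 9.1.
* [HatcherAT2002] A. Hatcher, Algebraic Topology, §2.1 Thm. 2.20, §3.1 p. 201.
-/

noncomputable section

open Complex ContinuousMap CategoryTheory Set
open Literature.AlgebraicTopology.SingularHomology

namespace Literature.Geometry.ComplexAnalytic

namespace PhamBrieskorn

section Localisation

variable (p : ℕ) {Y : Type} [TopologicalSpace Y]

/-- Conjugate self-maps have conjugate polynomial relations in homology: if `e ∘ g = μ ∘ e` for a homeomorphism
`e : A ≃ₜ F` and `Σ_{i<m} μ_*^i = 0` on `Hₙ(F; R)`, then `Σ_{i<m} g_*^i = 0` on `Hₙ(A; R)`.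
[cite: HatcherAT2002, §2.1] -/
theorem sum_pow_map_eq_zero_of_conj (R : Type) [CommRing R] {A F : Type} [TopologicalSpace A] [TopologicalSpace F]
    (e : A ≃ₜ F) (g : C(A, A)) (μ : C(F, F)) (hconj : (e : C(A, F)).comp g = μ.comp (e : C(A, F))) (n m : ℕ)
    (hμ : ∀ y : singularHomology R R F n, ∑ i ∈ Finset.range m, ((singularHomology.map R R μ n).hom ^ i) y = 0)
    (a : singularHomology R R A n) :
    ∑ i ∈ Finset.range m, ((singularHomology.map R R g n).hom ^ i) a = 0 := by
  -- `e_* (g_*^i a) = μ_*^i (e_* a)`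
  have hnat : ∀ (i : ℕ) (b : singularHomology R R A n),
      singularHomology.map R R (e : C(A, F)) n (((singularHomology.map R R g n).hom ^ i) b) =
        ((singularHomology.map R R μ n).hom ^ i) (singularHomology.map R R (e : C(A, F)) n b) := by
    intro i
    induction i with
    | zero => intro b; rw [pow_zero, pow_zero, Module.End.one_apply, Module.End.one_apply]
    | succ i ih =>
      intro b
      rw [pow_succ', pow_succ', Module.End.mul_apply, Module.End.mul_apply, ← ih]
      change singularHomology.map R R (e : C(A, F)) n (singularHomology.map R R g n _) =
        singularHomology.map R R μ n (singularHomology.map R R (e : C(A, F)) n _)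
      rw [← ModuleCat.comp_apply, ← singularHomology.map_comp, hconj, singularHomology.map_comp,
        ModuleCat.comp_apply]
  -- `e_*` is injective (homeomorphism)
  have hinj : Function.Injective (singularHomology.map R R (e : C(A, F)) n) :=
    ((forget (ModuleCat R)).mapIso (singularHomology.mapIso R R e n)).toEquiv.injective
  apply hinj
  rw [map_sum, map_zero, Finset.sum_congr rfl fun i _ => hnat i a]
  exact hμ _

/-- **The local-monodromy datum from a geometric monodromy conjugate to the model on a Milnor-ball piece.** Let
`Y = A ∪ B` be an open cover, `h : Y → Y` continuous with `h = id` on `B` and `h(A) ⊆ A` (restriction `h_A`), and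
suppose `h_A` is conjugate by a homeomorphism `A ≃ₜ F` to the model monodromy `(−z₀, −z₁, ζ z₂)` of the affine Milnor
fibre `F` of `z₀² + z₁² + z₂^p` (`ζ` a primitive `p`-th root of unity, `p ≥ 2`). Then every automorphism `T` of
`H²(Y; ℚ)` acting as `h^*` admits a subspace `V` (namely `(T − 1)H²`) with `T x − x ∈ V`, `Σ_{i<p} T^i = 0` on `V`
and `dim V ≤ p − 1` — the conclusion of `HodgeTheory.carlsonToledo1999_nodalMeridianLocalMonodromyBound` for `T`.
[cite: ArnoldGuseinzadeVarchenko2012, Part I §1.1 (held text p0013, p0025)] [cite: CarlsonToledo1999, §6 (kdoublept) (held text p0013)] -/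
theorem exists_localisation_of_conj_modelMonodromy (hp : 2 ≤ p) {ζ : ℂ} (hζ : IsPrimitiveRoot ζ p)
    {A B : Set Y} (hAo : IsOpen A) (hBo : IsOpen B) (hAB : A ∪ B = univ)
    (h : C(Y, Y)) (hB : ∀ y ∈ B, h y = y) (hA : C(↥A, ↥A)) (hhA : ∀ a : ↥A, ((hA a : ↥A) : Y) = h a)
    (e : ↥A ≃ₜ fibre (cyclicNodeExponents p))
    (hconj : (e : C(↥A, fibre (cyclicNodeExponents p))).comp hA =
      (((negPairFibre (cyclicNodeExponents p) (i := 0) (j := 1) (by decide) rfl rfl :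
          C(fibre (cyclicNodeExponents p), fibre (cyclicNodeExponents p))).comp
        (rotateFibre (cyclicNodeExponents p) (cyclicNodeExponents_ne_zero p (by omega))
          (⟨ζ, hζ.pow_eq_one⟩ : Omega (cyclicNodeExponents p (Fin.last 2))) :
          C(fibre (cyclicNodeExponents p), fibre (cyclicNodeExponents p)))).comp
        (e : C(↥A, fibre (cyclicNodeExponents p)))))
    (T : singularCohomology ℚ ℚ Y 2 ≃ₗ[ℚ] singularCohomology ℚ ℚ Y 2)
    (hT : ∀ x, T x = (singularCohomology.map ℚ ℚ h 2).hom x) :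
    ∃ V : Submodule ℚ (singularCohomology ℚ ℚ Y 2),
      (∀ x, T x - x ∈ V) ∧ (∀ v ∈ V, (∑ i ∈ Finset.range p, (T ^ i) v) = 0) ∧ Module.finrank ℚ V ≤ p - 1 := by
  have hmaps : Set.MapsTo h A A := fun a ha => by
    have := (hA ⟨a, ha⟩).2
    rwa [hhA ⟨a, ha⟩] at this
  -- powers of `T` are powers of `h^*`
  have hTi : ∀ (i : ℕ) (x : singularCohomology ℚ ℚ Y 2),
      (T ^ i) x = ((singularCohomology.map ℚ ℚ h 2).hom ^ i) x := by
    intro i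
    induction i with
    | zero => intro x; rw [pow_zero, pow_zero, Module.End.one_apply]; rfl
    | succ i ih => intro x; rw [pow_succ, pow_succ, LinearEquiv.mul_apply, Module.End.mul_apply, hT, ih]
  -- the local model transported to `A`: `H₂(A; ℚ)` is finite of dimension `p − 1`, `Σ (h_A)_*^i = 0` on it
  haveI hFfin : Module.Finite ℚ (singularHomology ℚ ℚ (fibre (cyclicNodeExponents p)) 2) :=
    finite_rat_singularHomology_fibre (a := cyclicNodeExponents p) (cyclicNodeExponents_ne_zero p (by omega))
      (two_le_cyclicNodeExponents p hp)
  let eH : singularHomology ℚ ℚ (↥A) 2 ≃ₗ[ℚ] singularHomology ℚ ℚ (fibre (cyclicNodeExponents p)) 2 :=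
    (singularHomology.mapIso ℚ ℚ e 2).toLinearEquiv
  haveI : Module.Finite ℚ (singularHomology ℚ ℚ (↥A) 2) := Module.Finite.equiv eH.symm
  have hdimA : Module.finrank ℚ (singularHomology ℚ ℚ (↥A) 2) = p - 1 := by
    rw [eH.finrank_eq, finrank_rat_singularHomology_fibre_cyclicNode p (by omega)]
  have hsumA : ∀ a : singularHomology ℚ ℚ (↥A) 2,
      ∑ i ∈ Finset.range p, (1 : ℚ) • ((singularHomology.map ℚ ℚ hA 2).hom ^ i) a = 0 := by
    intro a
    simp only [one_smul]
    refine sum_pow_map_eq_zero_of_conj ℚ e hA _ hconj 2 p (fun y => ?_) a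
    rw [map_modelMonodromy_eq_map_rotateFibre p ℚ (by omega)]
    exact sum_pow_map_rotateFibre_eq_zero ℚ (cyclicNodeExponents_ne_zero p (by omega))
      (a := cyclicNodeExponents p) (ζ := ζ) hζ y
  -- `V := (h^* − 1) H²(Y)`
  refine ⟨LinearMap.range ((singularCohomology.map ℚ ℚ h 2).hom - LinearMap.id), fun x => ⟨x, ?_⟩, ?_, ?_⟩
  · rw [LinearMap.sub_apply, LinearMap.id_apply, hT]
  · rintro _ ⟨x, rfl⟩
    rw [Finset.sum_congr rfl fun i _ => hTi i _]
    have h0 := sum_smul_pow_cohomologyMap_apply_sub_eq_zero ℚ h 2 p (fun _ => (1 : ℚ))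
      (fun z => singularHomology.sum_smul_pow_map_sub_self_eq_zero_of_eqOn ℚ ℚ hAo hBo hAB h hB hA hhA 2
        (fun _ => (1 : ℚ)) hsumA z) x
    simpa only [one_smul, LinearMap.sub_apply, LinearMap.id_apply] using h0
  · rw [finrank_range_cohomologyMap_sub_id_eq, ← hdimA]
    exact singularHomology.finrank_range_sub_id_le_of_eqOn ℚ ℚ hAo hBo hAB h hB hmaps 2

end Localisation

end PhamBrieskorn

end Literature.Geometry.ComplexAnalytic

end
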